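import Mathlib
import HarnessLib

/-!
# The real-analysis skeleton of the glue `SqueezedSkewness.TorusFloorsGlue` (stmt-QuantumFields-23206)
# (route-independent support; LINE α «torus-direct Källén–Lehmann» of planner ym-idea-6 g10)

One weight family `W ≥ 0` with decay ratios `μ ≥ 0` (NO upper bound `1`: the `μ_n > 1` atoms are the image charges of the
finite-period Källén–Lehmann representation `TorusKL`), and against it

* the reflection form of the small bump `v`: `HasSum (Wₙ · AVₙ) Q_v` (`AVₙ = |amp v|² ≥ 0`);
* the polarised low-pass floor: `HasSum (Wₙ · μₙ^{2m} χₙ) M` (`χₙ ∈ [0,1]` the low-pass indicator);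
* the antipodal mirror atom: `HasSum (Wₙ · μₙ^{2h}) N` with `m ≤ h`;
* Källén–Lehmann coherence of the high-ball bump `f` on the PHYSICAL atoms: `μₙ ≤ 1 ⇒ ½ μₙ^{2m} χₙ σ² ≤ AFₙ`;
* domination of `f` by `v` on the physical atoms: `μₙ ≤ 1 ⇒ c² AFₙ ≤ AVₙ` (`DivisibleBump` through `amp_dom`).

Then `c² · σ² (M − N) / 2 ≤ Q_v` (`glue_abstract_torus`): restrict every series to the physical atoms `μₙ ≤ 1`; on the
image atoms `μₙ > 1` the low-pass floor's terms are dominated by the mirror atom's (`μ^{2m} χ ≤ μ^{2h}`), so the physical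
part of `M` is at least `M − N`.  Pure `HasSum` bookkeeping over `ℝ`; no definitions; no summit / NT / crux statement is
touched. [folklore]
-/

set_option autoImplicit false

noncomputable section

open scoped BigOperators
open Filter Topology

namespace Summit.QuantumFields.YangMills.Theorems.SqueezedSkewnessTorusFloorsKit

/-- Splitting a summable non-negative family along a predicate: both halves are summable and the sums add up. [folklore] -/
theorem hasSum_ite_add {g : ℕ → ℝ} {M : ℝ} (hg0 : ∀ n, 0 ≤ g n) (hM : HasSum g M) (P : ℕ → Prop)
    [DecidablePred P] :
    Summable (fun n => if P n then g n else 0) ∧ Summable (fun n => if P n then 0 else g n) ∧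
      (∑' n, (if P n then g n else 0)) + (∑' n, (if P n then 0 else g n)) = M := by
  have h1 : Summable (fun n => if P n then g n else 0) :=
    hM.summable.of_nonneg_of_le (fun n => by split_ifs <;> simp [hg0 n])
      (fun n => by split_ifs <;> simp [hg0 n])
  have h2 : Summable (fun n => if P n then 0 else g n) :=
    hM.summable.of_nonneg_of_le (fun n => by split_ifs <;> simp [hg0 n])
      (fun n => by split_ifs <;> simp [hg0 n])
  refine ⟨h1, h2, ?_⟩
  have hadd := h1.hasSum.add h2.hasSum
  have hfun : (fun n => (if P n then g n else 0) + (if P n then 0 else g n)) = g := by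
    funext n; split_ifs <;> simp
  rw [hfun] at hadd
  exact hadd.unique hM

/-- **The real-analysis skeleton of `TorusFloorsGlue`.**  One weight family `W ≥ 0`, decay ratios `μ ≥ 0` (image atoms
`μ > 1` allowed); `HasSum (W·AV) Q_v`, `HasSum (W·μ^{2m}χ) M` (`0 ≤ χ ≤ 1`), `HasSum (W·μ^{2h}) N`, `m ≤ h`; on the physical
atoms `μₙ ≤ 1` the coherence bound `½ μₙ^{2m} χₙ σ² ≤ AFₙ` and the domination `c² AFₙ ≤ AVₙ`; all `AF, AV ≥ 0`.  Then
`c² · (σ² (M − N) / 2) ≤ Q_v`. [folklore] -/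
theorem glue_abstract_torus {W μ AF AV χ : ℕ → ℝ} {Qv M N σ c : ℝ} {m h : ℕ}
    (hW : ∀ n, 0 ≤ W n) (hμ : ∀ n, 0 ≤ μ n) (hχ0 : ∀ n, 0 ≤ χ n) (hχ1 : ∀ n, χ n ≤ 1)
    (hAV : ∀ n, 0 ≤ AV n)
    (hSV : HasSum (fun n => W n * AV n) Qv)
    (hSM : HasSum (fun n => W n * (μ n ^ (2 * m) * χ n)) M)
    (hSN : HasSum (fun n => W n * μ n ^ (2 * h)) N) (hmh : m ≤ h)
    (hKL : ∀ n, μ n ≤ 1 → 1 / 2 * (μ n ^ (2 * m) * χ n) * σ ^ 2 ≤ AF n)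
    (hdom : ∀ n, μ n ≤ 1 → c ^ 2 * AF n ≤ AV n) :
    c ^ 2 * (σ ^ 2 * (M - N) / 2) ≤ Qv := by
  classical
  set g : ℕ → ℝ := fun n => W n * (μ n ^ (2 * m) * χ n) with hg
  have hg0 : ∀ n, 0 ≤ g n := fun n => mul_nonneg (hW n) (mul_nonneg (pow_nonneg (hμ n) _) (hχ0 n))
  obtain ⟨hI, hJ, hsplit⟩ := hasSum_ite_add hg0 hSM (fun n => μ n ≤ 1)
  set MI : ℝ := ∑' n, (if μ n ≤ 1 then g n else 0) with hMI
  set MJ : ℝ := ∑' n, (if μ n ≤ 1 then 0 else g n) with hMJ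
  -- the image part of the low-pass floor is below the mirror atom
  have hMJN : MJ ≤ N := by
    refine hasSum_le (fun n => ?_) hJ.hasSum hSN
    split_ifs with hle
    · exact mul_nonneg (hW n) (pow_nonneg (hμ n) _)
    · have h1 : 1 ≤ μ n := (not_le.mp hle).le
      have hpow : μ n ^ (2 * m) ≤ μ n ^ (2 * h) := pow_le_pow_right₀ h1 (by omega)
      have : μ n ^ (2 * m) * χ n ≤ μ n ^ (2 * h) := by
        calc μ n ^ (2 * m) * χ n ≤ μ n ^ (2 * m) * 1 :=
              mul_le_mul_of_nonneg_left (hχ1 n) (pow_nonneg (hμ n) _)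
          _ ≤ μ n ^ (2 * h) := by rw [mul_one]; exact hpow
      exact mul_le_mul_of_nonneg_left this (hW n)
  -- the physical part carries the floor of `Q_v`
  have hQv : c ^ 2 * (1 / 2 * σ ^ 2) * MI ≤ Qv := by
    refine hasSum_le (fun n => ?_) (hI.hasSum.mul_left (c ^ 2 * (1 / 2 * σ ^ 2))) hSV
    split_ifs with hle
    · calc c ^ 2 * (1 / 2 * σ ^ 2) * g n = c ^ 2 * (W n * (1 / 2 * (μ n ^ (2 * m) * χ n) * σ ^ 2)) := by
            rw [hg]; ring
        _ ≤ c ^ 2 * (W n * AF n) :=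
            mul_le_mul_of_nonneg_left (mul_le_mul_of_nonneg_left (hKL n hle) (hW n)) (sq_nonneg c)
        _ = W n * (c ^ 2 * AF n) := by ring
        _ ≤ W n * AV n := mul_le_mul_of_nonneg_left (hdom n hle) (hW n)
    · rw [mul_zero]; exact mul_nonneg (hW n) (hAV n)
  have hMIge : M - N ≤ MI := by linarith
  have hcoef : 0 ≤ c ^ 2 * (1 / 2 * σ ^ 2) := by positivity
  calc c ^ 2 * (σ ^ 2 * (M - N) / 2) = c ^ 2 * (1 / 2 * σ ^ 2) * (M - N) := by ring
    _ ≤ c ^ 2 * (1 / 2 * σ ^ 2) * MI := mul_le_mul_of_nonneg_left hMIge hcoef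
    _ ≤ Qv := hQv

/-- The antipodal height `H = ⌊(2L+1)/4⌋` of the hypercube: `4H ≤ 2L+1`, `1 ≤ H` and `H + 2 ≤ L` once `L ≥ 5`. [folklore] -/
theorem antipodal_height_bounds (L : ℕ) (hL : 5 ≤ L) :
    4 * ((2 * L + 1) / 4) ≤ 2 * L + 1 ∧ 1 ≤ (2 * L + 1) / 4 ∧ (2 * L + 1) / 4 + 2 ≤ L := by
  refine ⟨Nat.mul_div_le (2 * L + 1) 4 |>.trans_eq' (by ring), ?_, ?_⟩
  · exact (Nat.le_div_iff_mul_le (by norm_num)).2 (by omega)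
  · have := Nat.mul_div_le (2 * L + 1) 4
    omega

/-- The low-pass height `m = ⌊5/(2s)⌋` sits below the antipodal height: `m + 1 ≤ ⌊(2L+1)/4⌋` once `0 < s ≤ 1` and
`8 ≤ s·L`; also `m + 3 ≤ L`. [folklore] -/
theorem lowPass_height_bounds {s : ℝ} (hs : 0 < s) (hs1 : s ≤ 1) (L : ℕ) (hsL : 8 ≤ s * L) :
    ⌊5 / (2 * s)⌋₊ + 1 ≤ (2 * L + 1) / 4 ∧ ⌊5 / (2 * s)⌋₊ + 3 ≤ L := by
  have hm : (⌊5 / (2 * s)⌋₊ : ℝ) ≤ 5 / (2 * s) := Nat.floor_le (by positivity)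
  have hL8 : (8 : ℝ) ≤ L := le_trans hsL (mul_le_of_le_one_left (Nat.cast_nonneg L) hs1)
  -- `5/(2s) ≤ 5L/16` from `8 ≤ sL`
  have h5 : 5 / (2 * s) ≤ 5 * (L : ℝ) / 16 := by
    rw [div_le_div_iff₀ (by positivity) (by norm_num)]
    nlinarith
  constructor
  · apply (Nat.le_div_iff_mul_le (by norm_num)).2
    have : ((⌊5 / (2 * s)⌋₊ + 1) * 4 : ℕ) ≤ ((2 * L + 1 : ℕ) : ℝ) := by
      push_cast
      nlinarith
    exact_mod_cast this
  · have : ((⌊5 / (2 * s)⌋₊ + 3 : ℕ) : ℝ) ≤ (L : ℝ) := by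
      push_cast
      nlinarith
    exact_mod_cast this

/-! ## Appendix (gen 2): supports of the two bumps, the height conditions of `TorusKL`, the numerical endgame -/

/-- Coordinates of points of the ball `closedBall(t·e₀, ρ')`: height within `ρ'` of `t`, norm at most `ρ' + |t|`, spatial
coordinates at most `ρ'` in absolute value. [folklore] -/
theorem coords_of_mem_closedBall_single (y : EuclideanSpace ℝ (Fin 4)) (t ρ' : ℝ)
    (hy : y ∈ Metric.closedBall (EuclideanSpace.single (0 : Fin 4) t) ρ') :
    |y 0 - t| ≤ ρ' ∧ ‖y‖ ≤ ρ' + |t| ∧ ∀ i : Fin 3, |y i.succ| ≤ ρ' := by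
  rw [Metric.mem_closedBall, dist_eq_norm] at hy
  refine ⟨?_, ?_, fun i => ?_⟩
  · have h0 := PiLp.norm_apply_le (y - EuclideanSpace.single (0 : Fin 4) t) 0
    have h0' : ‖(y - EuclideanSpace.single (0 : Fin 4) t) 0‖ = |y 0 - t| := by simp [Real.norm_eq_abs]
    rw [h0'] at h0
    exact h0.trans hy
  · have htri := norm_le_norm_add_norm_sub' y (EuclideanSpace.single (0 : Fin 4) t)
    have hs : ‖EuclideanSpace.single (0 : Fin 4) t‖ = |t| := by simp
    linarith
  · have h0 := PiLp.norm_apply_le (y - EuclideanSpace.single (0 : Fin 4) t) i.succ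
    have h0' : ‖(y - EuclideanSpace.single (0 : Fin 4) t) i.succ‖ = |y i.succ| := by
      simp [Real.norm_eq_abs, Fin.succ_ne_zero]
    rw [h0'] at h0
    exact h0.trans hy

/-- **Supports of the two bumps of `DivisibleBump`**: the high-ball bump `f` (`closedBall(2e₀, ½)`) and the small bump `v`
(`closedBall(e₀, ρ)`, slab `{δ₁ < y₀ < δ₂}`, `δ₁ > 0`) both live in `closedBall(0, 3 + ρ)` and at positive heights; `v` has heights
`≤ 1 + ρ` and spatial coordinates `≤ ρ < s(L + ½)` once `ρ + 1 ≤ sL`. [folklore] -/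
theorem bump_supports {f v : EuclideanSpace ℝ (Fin 4) → ℝ} {ρ δ₁ δ₂ : ℝ} (hρ : 0 ≤ ρ)
    (hfball : tsupport f ⊆ Metric.closedBall (EuclideanSpace.single (0 : Fin 4) (2 : ℝ)) (1 / 2))
    (hvball : tsupport v ⊆ Metric.closedBall (EuclideanSpace.single (0 : Fin 4) (1 : ℝ)) ρ)
    (hvslab : tsupport v ⊆ {y : EuclideanSpace ℝ (Fin 4) | δ₁ < y 0 ∧ y 0 < δ₂}) (hδ₁ : 0 < δ₁) :
    tsupport f ⊆ Metric.closedBall (0 : EuclideanSpace ℝ (Fin 4)) (3 + ρ) ∧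
    tsupport v ⊆ Metric.closedBall (0 : EuclideanSpace ℝ (Fin 4)) (3 + ρ) ∧
    tsupport f ⊆ {y : EuclideanSpace ℝ (Fin 4) | 0 < y 0} ∧
    tsupport v ⊆ {y : EuclideanSpace ℝ (Fin 4) | 0 < y 0} ∧
    tsupport v ⊆ {y : EuclideanSpace ℝ (Fin 4) | 0 < y 0 ∧ y 0 ≤ 1 + ρ} ∧
    ∀ (s : ℝ) (L : ℕ), ρ + 1 ≤ s * L → 0 < s →
      tsupport v ⊆ {y : EuclideanSpace ℝ (Fin 4) | ∀ i : Fin 3, |y i.succ| < s * (L + 1 / 2)} := by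
  have hv_pos : tsupport v ⊆ {y : EuclideanSpace ℝ (Fin 4) | 0 < y 0} := by
    intro y hy
    have h := hvslab hy
    simp only [Set.mem_setOf_eq] at h ⊢
    linarith [h.1]
  refine ⟨?_, ?_, ?_, hv_pos, ?_, ?_⟩
  · intro y hy
    have h := (coords_of_mem_closedBall_single y 2 (1 / 2) (hfball hy)).2.1
    rw [Metric.mem_closedBall, dist_zero_right]
    have : |(2 : ℝ)| = 2 := abs_of_pos two_pos
    linarith
  · intro y hy
    have h := (coords_of_mem_closedBall_single y 1 ρ (hvball hy)).2.1
    rw [Metric.mem_closedBall, dist_zero_right]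
    have : |(1 : ℝ)| = 1 := abs_of_pos one_pos
    linarith
  · intro y hy
    have h := (coords_of_mem_closedBall_single y 2 (1 / 2) (hfball hy)).1
    show 0 < y 0
    rcases abs_le.mp h with ⟨h1, _⟩
    linarith
  · intro y hy
    have h1 := hv_pos hy
    have h2 := (coords_of_mem_closedBall_single y 1 ρ (hvball hy)).1
    simp only [Set.mem_setOf_eq] at h1 ⊢
    obtain ⟨-, h2b⟩ := abs_le.mp h2
    exact ⟨h1, by linarith⟩
  · intro s L hsL hs y hy i
    have h3 := (coords_of_mem_closedBall_single y 1 ρ (hvball hy)).2.2 i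
    have : s * ((L : ℝ) + 1 / 2) = s * L + s / 2 := by ring
    linarith

/-- **The admissibility conditions `2H' + 3s ≤ sT` of `TorusKL`** on the hypercube `T = 2L+1` for the three families of test
functions of the glue: heights `≤ s(m+2)` (`m + 3 ≤ L`), `≤ s(H+1)` (`H + 2 ≤ L`), `≤ 1 + ρ` (`8 + ρ ≤ sL`, `s ≤ 1`). [folklore] -/
theorem heights_conditions {s ρ : ℝ} (hs : 0 < s) (hs1 : s ≤ 1) {L m H : ℕ} (hm3 : m + 3 ≤ L) (hH2 : H + 2 ≤ L)
    (hρL : 8 + ρ ≤ s * L) :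
    2 * (s * ((m + 1 : ℕ) + 1)) + 3 * s ≤ s * ((2 * L + 1 : ℕ) : ℝ) ∧
    2 * (s * ((H : ℕ) + 1)) + 3 * s ≤ s * ((2 * L + 1 : ℕ) : ℝ) ∧
    2 * (1 + ρ) + 3 * s ≤ s * ((2 * L + 1 : ℕ) : ℝ) := by
  refine ⟨?_, ?_, ?_⟩
  · have hm3' : ((m : ℝ) + 3) ≤ L := by exact_mod_cast hm3
    have hnn : 0 ≤ s * ((L : ℝ) - m - 3) := mul_nonneg hs.le (by linarith)
    have e : s * ((2 * L + 1 : ℕ) : ℝ) - (2 * (s * ((m + 1 : ℕ) + 1)) + 3 * s) = 2 * (s * ((L : ℝ) - m - 3)) := by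
      push_cast; ring
    linarith
  · have hH2' : ((H : ℝ) + 2) ≤ L := by exact_mod_cast hH2
    have hnn : 0 ≤ s * ((L : ℝ) - H - 2) := mul_nonneg hs.le (by linarith)
    have e : s * ((2 * L + 1 : ℕ) : ℝ) - (2 * (s * ((H : ℕ) + 1)) + 3 * s) = 2 * (s * ((L : ℝ) - H - 2)) := by
      push_cast; ring
    linarith
  · have e : s * ((2 * L + 1 : ℕ) : ℝ) = 2 * (s * L) + s := by push_cast; ring
    rw [e]
    linarith

/-- `‖(μ^k : ℂ)‖² = μ^{2k}` for real `μ`. [folklore] -/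
theorem norm_sq_ofReal_pow (μ : ℝ) (k : ℕ) : ‖((μ ^ k : ℝ) : ℂ)‖ ^ 2 = μ ^ (2 * k) := by
  rw [Complex.norm_real, Real.norm_eq_abs, sq_abs, ← pow_mul, mul_comm]

/-- **The numerical endgame**: `c₀/s⁴ ≤ σ`, `ε s⁸ ≤ M`, `N ≤ (ε/8) s⁸` and `c²·σ²(M − N)/2 ≤ Q` give `c²c₀²ε/4 ≤ Q`. [folklore] -/
theorem final_numbers {c c₀ ε s σ M N Q : ℝ} (hs : 0 < s) (hc₀ : 0 < c₀) (hε : 0 < ε)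
    (hσ : c₀ / s ^ 4 ≤ σ) (hM : ε * s ^ 8 ≤ M) (hN : N ≤ ε / 8 * s ^ 8)
    (key : c ^ 2 * (σ ^ 2 * (M - N) / 2) ≤ Q) : c ^ 2 * c₀ ^ 2 * ε / 4 ≤ Q := by
  have hMN : 7 / 8 * (ε * s ^ 8) ≤ M - N := by linarith
  have hσ0 : 0 < c₀ / s ^ 4 := by positivity
  have hσ2 : (c₀ / s ^ 4) ^ 2 ≤ σ ^ 2 := pow_le_pow_left₀ hσ0.le hσ 2
  have hprod : (c₀ / s ^ 4) ^ 2 * (7 / 8 * (ε * s ^ 8)) ≤ σ ^ 2 * (M - N) :=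
    mul_le_mul hσ2 hMN (by positivity) (sq_nonneg σ)
  have hval : (c₀ / s ^ 4) ^ 2 * (7 / 8 * (ε * s ^ 8)) = 7 / 8 * c₀ ^ 2 * ε := by
    field_simp
  rw [hval] at hprod
  have h1 : c ^ 2 * (7 / 8 * c₀ ^ 2 * ε / 2) ≤ c ^ 2 * (σ ^ 2 * (M - N) / 2) :=
    mul_le_mul_of_nonneg_left (by linarith) (sq_nonneg c)
  have h2 : c ^ 2 * c₀ ^ 2 * ε / 4 ≤ c ^ 2 * (7 / 8 * c₀ ^ 2 * ε / 2) := by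
    have : 0 ≤ c ^ 2 * c₀ ^ 2 * ε := by positivity
    nlinarith
  exact h2.trans (h1.trans key)

end Summit.QuantumFields.YangMills.Theorems.SqueezedSkewnessTorusFloorsKit

end
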